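import Mathlib
import HarnessLib
import HarnessLib.Audit
import Summits.FinalStateConjecture.Statement
import Literature.Geometry.Lorentzian.CoordCurvature
import Literature.Geometry.Lorentzian.KerrSchild
import HarnessLib.Audit.Status.Attr

/-!
Route: LeakageWritesInInk

# Route LeakageWritesInInk — leakage writes in ink — dark eternal vacuum exteriors are
time-analytic, time-analytic ones are stationary

It suffices to show X ∧ R, where X = EternalExteriorStationary is the SHARED eternal-exterior
Liouville node of route TemporalBandLiouville
(verbatim the same decl, so the item is wanted by both routes): a vacuum metric given by its
components G in ONE global harmonic coordinate
system on the eternal excised cylinder ℝ_t × {r(a,x⃗) > r₀} (`Kerr.region a r₀`; slices uniformly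
spacelike; spacelike inflow excision collar
= the chart shadow of κ > 0), two-sided bounded in every C^k and asymptotically flat at STATIONARY
rates uniformly in t (no radiation in or out,
ever: a DARK ETERNAL EXTERIOR) is t-independent; and R = StationaryLimitReduction (shared verbatim):
X → FinalStateConjecture (ω-limits of
late exteriors land in X's class; stationary ⇒ Kerr; capture; generic censorship and
sub-extremality). This route is the ALTERNATIVE
DECOMPOSITION of X dictated by card leakage-writes-in-ink: X ⇐ A → S with A = LeakageTimeAnalyticity
(dark eternal exteriors are
REAL-ANALYTIC IN TIME in a uniform strip — the card's cascade inequality + spectral bootstrap +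
red-shift cocycle, its K1/K2/P1) and
S = TimeAnalyticLiouville (a strip-analytic dark eternal exterior is stationary — the card's K3:
Tataru–Robbiano–Zuily–Hörmander continuation
needs pseudoconvexity only against ZERO-ENERGY null geodesics, so it sweeps the photon region for
free). A STRIP replaces the sibling route's
compact temporal BAND: it is what leakage can deliver (their own crux BandFromNonradiation concedes
semiclassics gives decay, not a band) and
it is all that S consumes.
Lean: `(∀ (a r₀ : ℝ) (G : Literature.Geometry.Lorentzian.E4 → Literature.Geometry.Lorentzian.E4
→L[ℝ] Literature.Geometry.Lorentzian.E4 →L[ℝ] ℝ), (0 < r₀ ∧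
Literature.Geometry.Lorentzian.MetricCoord.IsMetricOn G (Literature.Geometry.Lorentzian.Kerr.region
a r₀ : Set Literature.Geometry.Lorentzian.E4) ∧ (∃ c₀ δ : ℝ, 0 < c₀ ∧ 0 < δ ∧ ∀ x ∈
Literature.Geometry.Lorentzian.Kerr.region a r₀, (Literature.Geometry.Lorentzian.E4.dx 0)
(Literature.Geometry.Lorentzian.MetricCoord.sharpAt G x (Literature.Geometry.Lorentzian.E4.dx 0)) ≤
-c₀ ∧ (Literature.Geometry.Lorentzian.Kerr.radius a x < r₀ + δ → (fderiv ℝ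
(Literature.Geometry.Lorentzian.Kerr.radius a) x)
(Literature.Geometry.Lorentzian.MetricCoord.sharpAt G x (fderiv ℝ
(Literature.Geometry.Lorentzian.Kerr.radius a) x)) ≤ -c₀ ∧ c₀ ≤
(Literature.Geometry.Lorentzian.E4.dx 0) (Literature.Geometry.Lorentzian.MetricCoord.sharpAt G x
(fderiv ℝ (Literature.Geometry.Lorentzian.Kerr.radius a) x)))) ∧ (∀ x ∈
Literature.Geometry.Lorentzian.Kerr.region a r₀, Literature.Geometry.Lorentzian.MetricCoord.ricAt G
x = 0) ∧ (∀ x ∈ Literature.Geometry.Lorentzian.Kerr.region a r₀, ∑ β : Fin 4,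
Literature.Geometry.Lorentzian.MetricCoord.chrAt G x
(Literature.Geometry.Lorentzian.MetricCoord.sharpAt G x (Literature.Geometry.Lorentzian.E4.dx β))
(Literature.Geometry.Lorentzian.E4.basisVector β) = 0) ∧ (∀ k : ℕ, ∃ C : ℝ, ∀ x ∈
Literature.Geometry.Lorentzian.Kerr.region a r₀, ‖iteratedFDeriv ℝ k G x‖ ≤ C ∧
‖Literature.Geometry.Lorentzian.MetricCoord.sharpAt G x‖ ≤ C) ∧ (∃ C : ℝ, ∀ x ∈
Literature.Geometry.Lorentzian.Kerr.region a r₀, ‖G x -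
Literature.Geometry.Lorentzian.Minkowski.bilin‖ ≤ C / Literature.Geometry.Lorentzian.E4.spatialNorm
x ∧ ‖iteratedFDeriv ℝ 1 G x‖ ≤ C / Literature.Geometry.Lorentzian.E4.spatialNorm x ^ 2 ∧
‖iteratedFDeriv ℝ 2 G x‖ ≤ C / Literature.Geometry.Lorentzian.E4.spatialNorm x ^ 3)) → (∃ σ C : ℝ, 0
< σ ∧ ∀ x ∈ Literature.Geometry.Lorentzian.Kerr.region a r₀, ∀ v w :
Literature.Geometry.Lorentzian.E4, ∃ F : ℂ → ℂ, DifferentiableOn ℂ F {z : ℂ | |z.im| < σ} ∧ (∀ z :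
ℂ, |z.im| < σ → ‖F z‖ ≤ C * ‖v‖ * ‖w‖) ∧ ∀ s : ℝ, F (s : ℂ) = ((G (x + s •
Literature.Geometry.Lorentzian.E4.basisVector 0) v w : ℝ) : ℂ))) ∧ (EternalExteriorStationary →
_root_.FinalStateConjecture)`

## Assembly
Pure logic (sorry-free in Sketch.lean: `inkChain_holds`, `assembly_holds`, `closes`): for every (a,
r₀, G) in X's class, LeakageTimeAnalyticity
gives the strip, TimeAnalyticLiouville turns the strip into t-independence, so X holds;
StationaryLimitReduction maps X to the Statement. The
deciding theorem USES the cruxes: `closes … := hR (fun a r₀ G h ↦ hS a r₀ G h (hA a r₀ G h))`, with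
all eight items as hypotheses.

Rationale: WHY THIS LINE. An ω-limit of a non-settling censored development is ETERNAL and DARK, and every
filed "dark ⇒ stationary" engine (Rellich per frequency,
Carleman from 𝓘⁺ and 𝓗⁺, Titchmarsh band inflation) stalls on the open photon shell of a rotating
limit unless the limit is real-analytic in t
(Tataru doi:10.1080/03605309508821117, doi:10.1016/s0021-7824(99)00016-1; Robbiano–Zuily
doi:10.1007/s002220050212; Hörmander
doi:10.1007/978-1-4612-2014-5_9; Laurent–Léautaud doi:10.4171/jems/854: with t-analytic coefficients
unique continuation needs pseudoconvexity
only on {τ = 0}), a hypothesis smooth data cannot supply and waves cannot weaken (Alinhac–Baouendi).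
The card MANUFACTURES it: Littlewood–Paley
in t alone commutes with everything spatial, eternity + darkness make the λ-component of G the
purely retarded response to its own quadratic
self-interaction (polynomial-loss high-frequency estimates through normally hyperbolic trapping,
WunschZworski2011, doi:10.5802/aif.3005,
DafermosRodnianskiShlapentokhrothman2014, arXiv:2212.14093; 'no incoming from 𝓗⁻' is the κ > 0
red-shift read on two-sided bounds), the
paraproduct gives the CASCADE INEQUALITY a(λ) ≤ Cλ^N sup_{μ∈[λ/16,λ/2]} a(μ)a(λ−μ), and the two-line
SPECTRAL BOOTSTRAP (support item, kit
j001373 of the card) turns rapid decay + cascade into e^{−cλ} with no Gevrey purgatory: strip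
analyticity, radius set by leakage. Imported
areas with explicit dictionary: dissipative attractor theory (FoiasTemam1989,
doi:10.1512/iumj.1998.47.1465, doi:10.1016/s0021-7824(03)00045-x:
"νk² beats the cascade" ↦ "leakage beats the cascade, with LOSS λ^N instead of gain"), Komech's
attractors for U(1)-Hamiltonian PDE
(KomechKomech2006, Komech2021: compact spectrum from a mass gap ↦ exponential spectral decay from no
gap + leakage), double-Duhamel regularity
of almost-periodic critical elements (arXiv:math/0611402), Fermi/Doppler pumping on moving trapped
rays (doi:10.1016/0022-1236(82)90105-7,
doi:10.1515/crelle.2008.015 — the super-critical side of the card's heating–roughness law), and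
partially-analytic Carleman theory as the
consumer. Relative to the 39 filed FSC routes: EternalPapapetrou names t-analyticity as the resource
its no-hair crux lacks and stops there;
TemporalBandLiouville asks for a compact band (strictly more than S uses); AnalyticInheritance
inherits SPATIAL analyticity from analytic
data; TwoBoundarySqueeze crosses the trapped set only where it is a hypersurface. Negatives index:
empty (2026-08-15).

RANKED CRUXES. #0 EternalExteriorStationary (target) — X (shared verbatim with
TemporalBandLiouville.EternalExteriorStationary): for all a, r₀ > 0 and G : E4 → (E4 →L E4 →L ℝ)
with IsMetricOn G on Kerr.region a r₀; slices {t = const} uniformly spacelike (g⁻¹(dt,dt) ≤ −c₀);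
excision collar {r < r₀+δ} with dr timelike and inflow; Ric(G) = 0; harmonic coordinates; every C^k
norm of G and ‖G⁻¹‖ bounded on the whole cylinder; ‖G−η‖ ≤ C/ρ, ‖DG‖ ≤ C/ρ², ‖D²G‖ ≤ C/ρ³ uniformly
in t — THEN G(x + s e₀) = G(x) for all s. Here reached as InkChain: LeakageTimeAnalyticity →
TimeAnalyticLiouville → X. (why it might fail: X fails iff a vacuum breather exists in this class
(eternal, bounded, dark, non-stationary): hair guided by trapped zero-energy null geodesics in the
ergo-belt of a non-Kerr hole, or a geon-like core behind stable trapping; none known, none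
excluded.) [AlexakisSchlue2018, BicakScholtzTod2010, IonescuKlainerman2008, IonescuKlainerman2012,
DafermosLuk2017]
#2 LeakageTimeAnalyticity (crux) — LEAKAGE WRITES IN INK (card K1 + K2 + P1): under the hypotheses
of X alone, G is real-analytic in t in a UNIFORM STRIP — there are σ > 0 and C such that every
component t ↦ G(x + t e₀)(v,w) is the restriction of a function holomorphic on {|Im z| < σ} bounded
by C‖v‖‖w‖, uniformly over the cylinder (the strip-analyticity clause is verbatim the hypothesis of
the shared support item StaticZoneLiouville). Intended proof: temporal Littlewood–Paley profile a(λ)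
= sup‖P_λ G‖_{C^k}; beyond a threshold frequency each P_λ G is the purely retarded response of the
reduced harmonic-gauge system linearised at the band-limited (entire-in-t) background P_{<λ/16}G to
the high×high paraproduct source (eternity + no incoming radiation at order 1/ρ + red-shift on
two-sided bounds: no free high-frequency content, no real resonances, polynomial resolvent loss λ^N
through hyperbolic trapping); this is the CASCADE INEQUALITY, and SpectralBootstrap converts rapid
decay + cascade into a(λ) ≤ C′e^{−cλ}, i.e. a uniform strip. The one loophole — net heating χ > 0 of
the red-shift cocycle on a moving trapped ray — would put a power-law floor λ^{−γ/χ} under a(λ)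
(Doppler/Fermi pumping), contradicting smoothness, so smooth limits do not heat and the transfer
stays frequency-local. [difficulty: open-problem] (why it might fail: High-frequency estimates with
polynomial loss exist only for stationary or slowly varying metrics: on G the trapped set moves
(Ehrenfest-time beam control open); stable trapping (loss e^{cλ}) or a heating ray χ>0 voids the
cascade — the conclusion may still hold, the engine would not.) [WunschZworski2011,
doi:10.5802/aif.3005, DafermosRodnianskiShlapentokhrothman2014, arXiv:2212.14093, FoiasTemam1989,
doi:10.1512/iumj.1998.47.1465, doi:10.1016/s0021-7824(03)00045-x, arXiv:math/0611402,
doi:10.1515/crelle.2008.015, doi:10.1016/0022-1236(82)90105-7, Sbierski2015, Aretakis2015]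
#3 TimeAnalyticLiouville (crux) — TIME-ANALYTIC LIOUVILLE (card K3, consumer of rank 2): under the
hypotheses of X, if G is real-analytic in t in a uniform strip (the conclusion of
LeakageTimeAnalyticity, verbatim), then G is t-independent on the whole cylinder. Intended proof: h
= ∂ₜG solves the linearisation of the autonomous reduced vacuum system at G EXACTLY, with
coefficients analytic in t; far zone: StaticZoneLiouville (Fourier in t + Rellich–Vekua kills h near
infinity, the t-analytic Tataru–Robbiano–Zuily–Hörmander theorem sweeps coordinate spheres inward);
photon region: wherever ∂ₜ is timelike the operator is transversally elliptic on {τ = 0} and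
continuation crosses EVERY surface with no convexity at all; ergo-belt: pseudoconvexity is needed
only against null bicharacteristics annihilating ∂ₜ — ZERO-ENERGY null geodesics — i.e.
Ionescu–Klainerman's T-conditional pseudoconvexity of the limit (verified at and near Kerr), or the
zero-energy Kerr-or-bomb dichotomy of the sibling cards; collar inside the horizon: two-sided bounds
+ blue-shift backwards (κ > 0) + domain of dependence. Strictly stronger than
TemporalBandLiouville.BandLimitedLiouville (weaker hypothesis), with the same engine outside the
belt. [deps: LeakageTimeAnalyticity] [difficulty: open-problem] (why it might fail: The belt: a
t-analytic breather non-stationary exactly on a T-trapped pocket of zero-energy null geodesics in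
the ergoregion of a non-Kerr limit passes every TRZH sweep (T-pseudoconvexity is known only near
Kerr); the transport half of the tensorial system must respect Tataru's conjugation.)
[doi:10.1080/03605309508821117, doi:10.1016/s0021-7824(99)00016-1, doi:10.1007/s002220050212,
doi:10.1007/978-1-4612-2014-5_9, doi:10.4171/jems/854, IonescuKlainerman2008,
AlexakisIonescuKlainerman2010, AlexakisSchlue2018, IonescuKlainerman2012]
#4 StationaryLimitReduction (crux) — THE STATIONARY-LIMIT ARCHITECTURE (shared verbatim with
TemporalBandLiouville.StationaryLimitReduction; the card's K4 "limits carry the hypotheses" lives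
here): X → FinalStateConjecture. Informally: (i) for Christodoulou-generic admissible data the MGHD
exists, has complete 𝓘⁺, and its exterior admits late-time comoving harmonic charts with two-sided
C^k bounds, so that every ω-limit around each final concentration region is a G in X's class
(excised inside the apparent horizon — the spacelike inflow collar IS the generic sub-extremality κ
> 0 — stationary-rate fall-off because Bondi mass and horizon area are constant on ω-limits, no
𝓗⁻-content by the two-sided NP hierarchy ∂ᵥX = nκX + lower), or is empty (dispersal); (ii) by X each
limit is stationary, hence (smooth black-hole uniqueness in this class) a sub-extremal Kerr
exterior, generically; (iii) uniqueness of the limit plus Kerr capture upgrades subsequential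
convergence to the C² FinalStateDecomposition with HasExhaustiveCharts. [deps:
EternalExteriorStationary] [difficulty: open-problem] (why it might fail: Contains weak cosmic
censorship, C^k-compactness of late exteriors in comoving harmonic gauge up to the horizon (Burnett:
weak limits may leave vacuum), smooth stationary ⇒ Kerr (open beyond near-Kerr/analytic) and
sub-extremal capture (known for |a| ≪ M only).) [DafermosLuk2017, arXiv:2104.11857,
arXiv:2205.14808, arXiv:1907.10743, IonescuKlainerman2008, KenigMerle2006,
DafermosHolzegelRodnianskiTaylor2021]
#9 StaticZoneLiouville (support) — THE FAR-ZONE HALF OF TimeAnalyticLiouville (shared verbatim with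
TemporalBandLiouville.StaticZoneLiouville): under the hypotheses of X, if G is time-analytic in a
uniform strip and on the far zone {ρ ≥ r₁} the field ∂ₜ is uniformly timelike and the coordinate
spheres uniformly non-characteristic, then G is t-independent on {ρ > r₁} (Fourier in t +
Rellich–Vekua for the weakly coupled Helmholtz system with Coulomb tails; TRZH
transversally-elliptic sweep inward). [difficulty: L] [doi:10.1080/03605309508821117,
doi:10.4171/jems/854, AlexakisSchlue2018, BicakScholtzTod2010]
#9 SpectralBootstrap (support) — THE SPECTRAL BOOTSTRAP (card P1(a), pure real analysis,
Mathlib-provable now): a profile a : ℝ → [0,1] with rapid decay (∀K, a(λ) ≤ C_K λ^{−K} for λ ≥ 1)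
and the cascade inequality (for λ ≥ λ₁ some μ ∈ [λ/16, λ/2] has a(λ) ≤ Cλ^N a(μ)a(λ−μ), C > 0)
decays exponentially: a(λ) ≤ C′e^{−cλ} for λ ≥ 1 with c > 0. Proof (checked by hand): induction over
shells [Λ, 16Λ/15) on the claim a(ν) ≤ D e^{−ν/λ*} ν^{−(N+1)} for ν ≥ λ*/16, base window [λ*/16, λ*)
from rapid decay at order N+2, step from μ(λ−μ) ≥ λ²/32, with λ* = max(λ₁, 16,
(16e·C·C_{N+2}·32^{N+1})^{1/2}), D = 16e·C_{N+2}/λ*; exponentials are the fixed points of the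
cascade convolution (card kit j001373: no sublinear regime). [difficulty: provable-now]
[FoiasTemam1989, doi:10.1512/iumj.1998.47.1465]
#9 InkChain (support) — the two cruxes compose to the shared target by pure logic (the hypothesis
bundles are syntactically identical; `inkChain_holds` in Sketch.lean): LeakageTimeAnalyticity →
TimeAnalyticLiouville → EternalExteriorStationary. [difficulty: provable-now]
[doi:10.1016/s0021-7824(99)00016-1]

TWO-LAYER PLAN. Foreseen glued splits (none filed now; k ≤ 3, depth 1). A ⇐ TransferBound (card K1:
on a dark eternal G with non-heating hyperbolic trapping
the retarded response to a temporal-frequency-ν source is frequency-LOCAL with polynomial loss,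
sup_t‖P_λ R_ret S_ν‖ ≤ Cλ^N⟨log(λ/ν)⟩^{−M}
sup_t‖S_ν‖, uniformly along the entire-in-t backgrounds P_{<λ/16}G) → NoHeating (card K2,
heating–roughness law: a uniformly C^∞
non-stationary dark eternal vacuum G has top red-shift-cocycle exponent χ ≤ 0 on every trapped null
ray, because χ > 0 with escape rate γ
caps the temporal Sobolev regularity of generic retarded responses at γ/χ + C) → CascadeFromTransfer
(paraproduct bookkeeping for the
reduced harmonic-gauge system: low×high terms are lower-order parts of the LINEAR propagator; output
a(λ) ≤ Cλ^N sup a(μ)a(λ−μ); then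
SpectralBootstrap) → A; definitions RedShiftCocycle / TemporalSpectralProfile requested at that
time. S ⇐ StaticZoneLiouville (filed) →
PhotonRegionSweep (TRZH transversally-elliptic continuation of h = ∂ₜG = 0 from {ρ > r₁} to the
closure of {G(e₀,e₀) < 0}) → BeltAndCollar
(zero-energy T-pseudoconvexity of the limit's ergo-belt, or Kerr-or-bomb of cards
zero-energy-optics-kerr-or-bomb / fill-the-belt; collar by
blue-shift backwards) → S. R ⇐ OmegaLimitsExist (card K4) → StationaryIsKerr → CaptureAndCharts,
shared with TemporalBandLiouville, only
after X moves. A linear/semilinear RUNG of A is the natural first prover target inside A (card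
P1(b): eternal bounded purely retarded
solutions of □_{g_{M,a}}u = N(u,∂u), N analytic, on exact sub-extremal Kerr are t-analytic —
resolvent bound + paraproduct + SpectralBootstrap),
to be attached with `--supports LeakageTimeAnalyticity`, never an item.

KILL CRITERIA. refuted:LeakageTimeAnalyticity by a smooth, eternal, two-sided bounded, dark,
NON-t-analytic vacuum exterior in X's class (or, at the rung,
a bounded eternal purely retarded non-analytic solution of an analytic semilinear wave equation on
sub-extremal Kerr) kills the card's engine:
close `refuted:LeakageTimeAnalyticity` unless the witness uses stable trapping / a heating ray, in
which case restate A with the card's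
provisos (hyperbolic non-heating trapping) as a NEW item and re-certify the glue.
refuted:TimeAnalyticLiouville by a t-analytic vacuum
breather (necessarily belt-supported) refutes X too: both this route and TemporalBandLiouville close
`refuted:` and the witness goes to the
negatives index and to card zero-energy-optics-kerr-or-bomb as its "bomb".
refuted:EternalExteriorStationary directly: same. A proof of
BandFromNonradiation (sibling route) makes A `known`-by-implication (band ⇒ entire ⇒ strip) —
supersede A, keep S (it is the stronger
Liouville half the sibling then needs). StationaryLimitReduction dies only with the conjecture; if
X's typed class turns out to EXCLUDE Kerr
in horizon-penetrating harmonic coordinates (non-vacuity falsifier below) both routes restate X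
together.

NOT DECOMPOSED YET. Everything under A (the transfer bound on a moving trapped set, the
heating–roughness law, the paraproduct bookkeeping, the semilinear rung,
the curvature-level gauge-free variant □_G Rm = Rm∗Rm of the card's P1(c)); the belt and collar
pieces of S; every piece of R (ω-limit
compactness in comoving harmonic gauge, no-hair for stationary limits, capture, genericity of
complete 𝓘⁺ and of κ > 0); the exact k in the
C^k clauses (X quantifies all k); the Literature facts provers will want as hypotheses (TRZH
theorem, Wunsch–Zworski / Dyatlov resolvent
bounds, DRSR scattering unitarity DafermosRodnianskiShlapentokhrothman2018) — layer-2 children or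
cite requests, later (D-0019).

CHEAPEST FALSIFIER. (1) The bootstrap: could the extremal cascade recursion grow sublinearly (Gevrey
only — useless for wave UC)? The card ran it (kit j001373,
grid to λ = 10⁹, N = 4): no, φ(λ)/λ → const ≠ 0 from every start, and the hand proof in the
SpectralBootstrap block closes with explicit λ*, D.
(2) LINEAR pilot, a lookup: must an eternal, C^k-bounded solution of □_g ψ = 0 on sub-extremal Kerr
with vanishing radiation fields on 𝓘⁺ AND 𝓘⁻
be constant? In finite energy yes (bijective DRSR scattering map,
DafermosRodnianskiShlapentokhrothman2018); a bounded-class counterexample would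
be zero-frequency hair, where the bootstrap does not operate — consistent, not a kill. (3)
Non-vacuity of X's class (shared with
TemporalBandLiouville): Kerr, 0 < |a| < M, in Cook–Scheel horizon-penetrating harmonic coordinates
must satisfy the seven clauses (collar between
r₋ and r₊); failure restates X for both routes. One CAS afternoon; not run on this compute-free
seat. (4) The card's K2 toy (kit j001430/j001437):
heating ladders flatter than the χ = 0 control by 1.9× at equal δ and ∝ 1/δ, as the
heating–roughness law predicts.

NUMBERS. Trapping on sub-extremal Kerr is normally hyperbolic for all |a| < M with polynomial
(indeed logarithmic-loss) high-frequency resolvent bounds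
(WunschZworski2011; doi:10.5802/aif.3005; DafermosRodnianskiShlapentokhrothman2014 for the full
range); universal loss without trapping
assumptions is e^{Cλ} (Burq1998) — the bootstrap tolerates any λ^N, not e^{cλ}. Cascade pairing
window μ ∈ [λ/16, λ/2] ⇒ μ(λ−μ) ≥ λ²/32;
threshold λ* = max(λ₁, 16, (16e·C·C_{N+2}·32^{N+1})^{1/2}), radius c = 1/λ*. Gevrey s > 1 is NOT
enough for wave unique continuation
(Hörmander's Gevrey counterexample; doi:10.4310/mrl.2000.v7.n5.a7), s = 1 is — hence the insistence
on "no Gevrey purgatory". Ergoregion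
non-empty iff a ≠ 0 and no constant Killing combination is timelike on a rotating exterior
(Literature.Barriers.FinalStateConjecture.KerrSuperradiance,
KerrNoTimelikeKillingCombination) — so the free transversally-elliptic regime of S never covers a
rotating belt. Items at open: 8 (3 cruxes,
1 target, 1 assembly, 3 support).

DEFINITION REQUESTS. None needed for typing: everything is stated over
Literature.Geometry.Lorentzian.MetricCoord (IsMetricOn, sharpAt, ricAt, chrAt),
Kerr.region / Kerr.radius, Minkowski.bilin, E4.dx / basisVector / spatialNorm and Mathlib's
DifferentiableOn ℂ / iteratedFDeriv / Real.exp.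
Wanted at split time (tenure), under Summits/FinalStateConjecture/FinalStateConjecture/Theorems:
`TemporalSpectralProfile` (Littlewood–Paley
in t of a field on the cylinder, sup over t and a spatial C^k norm), `RedShiftCocycle` (E = −G(∂ₜ,
γ̇) along a null geodesic γ of G as a
multiplicative cocycle over the t-translation flow on the trapped set; top exponent χ), and the
convenience bundle
`IsDarkEternalHarmonicExterior a r₀ G` (the 7-clause antecedent of X, shared with
TemporalBandLiouville — only if both routes migrate together,
since a signature change makes new items). Cite facts wanted later (kind cite, family gr): the
Tataru–Robbiano–Zuily–Hörmander theorem
(doi:10.1016/s0021-7824(99)00016-1, doi:10.1007/s002220050212, doi:10.4171/jems/854 Def. 1.5 ff.),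
resolvent bounds for normally hyperbolic
trapping (WunschZworski2011, doi:10.5802/aif.3005), DRSR scattering bijectivity
(DafermosRodnianskiShlapentokhrothman2018).

Novelty: Searches (2026-08-15; searchd local index unavailable (rc 75) all session, remote cascade up): `lit
frontier FinalStateConjecture --since 2022`
(30 rows: trapped-surface formation, Kerr(-dS) stability, smooth-null-infinity V, multi-hole data,
DHRT quasilinear arXiv:2212.14093 — nothing on
eternal/time-analytic rigidity); `lit bridges FinalStateConjecture --cross any` (30 rows, surveys);
`lit search --source crossref "unique
continuation partially analytic coefficients Tataru"` (6: doi:10.1016/s0021-7824(99)00016-1,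
doi:10.4171/jems/854, Koch–Tataru); `--source
crossref "Robbiano Zuily … partially holomorphic coefficients"` (doi:10.1007/s002220050212);
`--source crossref "regularity in time of solutions
on the global attractor damped wave equation analytic"` (8: Carvalho–Cholewa 2008, Goubet 2018,
Moise–Rosa 1997 — all UNIFORMLY damped/forced);
`--source crossref "Hale Raugel regularity determining modes"` (doi:10.1016/s0021-7824(03)00045-x);
`--source crossref "Oliver Titi analyticity of
the attractor"` (doi:10.1512/iumj.1998.47.1465); `--source arxiv "resolvent estimates normally
hyperbolic trapping Kerr"` (1: arXiv:1003.4640);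
`--source crossref "Dyatlov spectral gaps normally hyperbolic trapping"` (doi:10.5802/aif.3005,
Hintz–Vasy doi:10.4310/mrl.2014.v21.n6.a5);
`--source crossref "Doppler heating trapped ray moving obstacle energy growth"` (6, none beyond Kian
2012 periodic non-trapping); `--source zbmath
"bounded entire solutions nonlinear wave equation time analytic Li  [refs: 10.1016/s0021-7824(99, 10.4171/jems/854, 10.1007/s002220050212, 10.1016/s0021-7824(03, 10.1512/iumj.1998.47.1465, 10.5802/aif.3005, 10.4310/mrl.2014.v21.n6.a5, 2212.14093, 1003.4640, math/0611402, doi:10.1016/s0021-7824, doi:10.4171/jems/854, doi:10.1007/s002220050212, doi:10.1512/iumj.1998.47.1465, doi:10.5802/aif.3005, doi:10.4310/mrl.2014.v21.n6.a5, KomechKomech2006]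

Barriers (technique_class: temporal-cascade, red-shift-cocycle, time-analytic-UC): - technique_class: temporal-cascade, red-shift-cocycle, time-analytic-UC
- Literature.Barriers.FinalStateConjecture.SbierskiTrappingObstruction: evaded — no integrated decay
WITHOUT loss is claimed anywhere; the cascade inequality tolerates any polynomial loss λ^N
(SpectralBootstrap is loss-blind up to polynomials), and Gaussian beams re-enter only as the probe
defining the red-shift cocycle; conceded: stable trapping (loss e^{cλ}, Burq1998) voids A's engine —
the bomb/geon branch owned by zero-energy-optics-kerr-or-bomb / no-soft-geons.
- Literature.Barriers.FinalStateConjecture.IonescuKlainermanNonExtension: evaded in kind — nothing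
is continued across the characteristic horizon or built from local horizon data; S continues INWARD
from the Rellich zone with analyticity in t EARNED by A (IK's counterexamples are smooth, stationary
and local, excluded by global eternal darkness), and the conceded residual is global: zero-energy
null convexity of the whole belt.
- Literature.Barriers.FinalStateConjecture.KerrSuperradiance: marks exactly where S stops being free
— ∂ₜ spacelike in the ergoregion (KerrNoTimelikeKillingCombination: no constant Killing combination
rescues a rotating belt); no ∂ₜ-energy positivity is used anywhere, the belt is declared the crux of
S.
- Literature.Barriers.FinalStateConjecture.AretakisInstability: delimiter — κ > 0 enters twice (the
spacelike inflow collar of X's class; two-sided bounds kill each e^{nκv} branch of 𝓗⁻-content); at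
extremality the red-

History (route lifecycle, newest last):
- 2026-08-16T04:02:22Z · AUTO-CRUX (backfill): EternalExteriorStationary — hypotheses of the deciding theorem that nothing in the route derives are cruxes (operator:999:1085951)
- 2026-08-23T09:27:47Z · DORMANT — reconciler: no traction for 6 d (last activity item-evidence-added at 2026-08-17T07:58:05Z); parked, not closed — `ledger route dormant route-FinalStateConjectu (operator:999:1844618)
- 2026-08-31T08:38:09Z · REACTIVATED (open) — reconciler: reactivated — activity statement-checked at 2026-08-31T07:24:24Z after parking at 2026-08-23T09:27:47Z (operator:999:630741)

sub-problem: FinalStateConjecture · status: open · opened planner-plancard-FinalStateConjecture-FinalSt-de58c9be-0 2026-08-15T15:36:41Z · rev 4 · ledger route-FinalStateConjecture-LeakageWritesInInk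
GENERATED by the gate from the ledger (D-0016/17). Provers cite these decls: `theorem foo : Summit.FinalStateConjecture.FinalStateConjecture.Theses.LeakageWritesInInk.<Decl> := …` in Summits/FinalStateConjecture/FinalStateConjecture/Theorems/<Name>.lean.
-/

namespace Summit.FinalStateConjecture.FinalStateConjecture.Theses.LeakageWritesInInk

open scoped BigOperators Topology Manifold Classical MeasureTheory ProbabilityTheory Matrix InnerProductSpace ComplexConjugate ContinuousMap
open Filter Set Function TopologicalSpace MeasureTheory

attribute [summit_statement] _root_.FinalStateConjecture

/-- item stmt-FinalStateConjecture-10170 · crux (kind.auto-crux: conjecture-grade) · rank 0 · open · by planner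
why it might fail: X fails iff a vacuum breather exists in this class (eternal, two-sided C^k-bounded, dark, non-stationary harmonic-gauge exterior): hair riding trapped zero-energy null geodesics in the ergo-belt of a non-Kerr hole, or a core behind stable trapping; none known, none excluded (arXiv:1504.04592 p.4).
sources: arXiv:1504.04592, BicakScholtzTod2010, AlexakisIonescuKlainerman2010, IonescuKlainerman2012, arXiv:1710.01722
[target] X. For all a, r₀ > 0 and G : E4 → (E4 →L E4 →L ℝ) with: IsMetricOn G on Kerr.region a r₀
(smooth, symmetric, invertible); slices {t = const} uniformly spacelike (g⁻¹(dt,dt) ≤ −c₀); excision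
collar {r < r₀+δ} with dr timelike and inflow (g⁻¹(dr,dr) ≤ −c₀, g⁻¹(dt,dr) ≥ c₀); Ric(G) = 0;
harmonic coordinates g^{αβ}Γ^μ_{αβ} = 0; every C^k norm of G and ‖G⁻¹‖ bounded on the whole
cylinder; ‖G−η‖ ≤ C/ρ, ‖DG‖ ≤ C/ρ², ‖D²G‖ ≤ C/ρ³ (ρ = |x⃗|) — THEN G(x + s e₀) = G(x) for all s (∂_t
is Killing). Black-hole case of "eternal two-sided non-radiating vacuum exteriors are stationary";
the horizonless sibling (no excision) is left to the no-geon cards. -/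
@[route_item "route-FinalStateConjecture-LeakageWritesInInk", crux]
def EternalExteriorStationary : Prop :=
  ∀ (a r₀ : ℝ) (G : Literature.Geometry.Lorentzian.E4 → Literature.Geometry.Lorentzian.E4 →L[ℝ] Literature.Geometry.Lorentzian.E4 →L[ℝ] ℝ), (0 < r₀ ∧ Literature.Geometry.Lorentzian.MetricCoord.IsMetricOn G (Literature.Geometry.Lorentzian.Kerr.region a r₀ : Set Literature.Geometry.Lorentzian.E4) ∧ (∃ c₀ δ : ℝ, 0 < c₀ ∧ 0 < δ ∧ ∀ x ∈ Literature.Geometry.Lorentzian.Kerr.region a r₀, (Literature.Geometry.Lorentzian.E4.dx 0) (Literature.Geometry.Lorentzian.MetricCoord.sharpAt G x (Literature.Geometry.Lorentzian.E4.dx 0)) ≤ -c₀ ∧ (Literature.Geometry.Lorentzian.Kerr.radius a x < r₀ + δ → (fderiv ℝ (Literature.Geometry.Lorentzian.Kerr.radius a) x) (Literature.Geometry.Lorentzian.MetricCoord.sharpAt G x (fderiv ℝ (Literature.Geometry.Lorentzian.Kerr.radius a) x)) ≤ -c₀ ∧ c₀ ≤ (Literature.Geometry.Lorentzian.E4.dx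 0) (Literature.Geometry.Lorentzian.MetricCoord.sharpAt G x (fderiv ℝ (Literature.Geometry.Lorentzian.Kerr.radius a) x)))) ∧ (∀ x ∈ Literature.Geometry.Lorentzian.Kerr.region a r₀, Literature.Geometry.Lorentzian.MetricCoord.ricAt G x = 0) ∧ (∀ x ∈ Literature.Geometry.Lorentzian.Kerr.region a r₀, ∑ β : Fin 4, Literature.Geometry.Lorentzian.MetricCoord.chrAt G x (Literature.Geometry.Lorentzian.MetricCoord.sharpAt G x (Literature.Geometry.Lorentzian.E4.dx β)) (Literature.Geometry.Lorentzian.E4.basisVector β) = 0) ∧ (∀ k : ℕ, ∃ C : ℝ, ∀ x ∈ Literature.Geometry.Lorentzian.Kerr.region a r₀, ‖iteratedFDeriv ℝ k G x‖ ≤ C ∧ ‖Literature.Geometry.Lorentzian.MetricCoord.sharpAt G x‖ ≤ C) ∧ (∃ C : ℝ, ∀ x ∈ Literature.Geometry.Lorentzian.Kerr.region a r₀, ‖G x - Literature.Geometry.Lorentzian.Minkowski.bilin‖ ≤ C / Literature.Geometry.Lorentzian.E4.spatialNorm x ∧ ‖iteratedFDeriv ℝ 1 G x‖ ≤ C / Literature.Geometry.Lorentzian.E4.spatialNorm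 x ^ 2 ∧ ‖iteratedFDeriv ℝ 2 G x‖ ≤ C / Literature.Geometry.Lorentzian.E4.spatialNorm x ^ 3)) → ∀ x ∈ Literature.Geometry.Lorentzian.Kerr.region a r₀, ∀ s : ℝ, G (x + s • Literature.Geometry.Lorentzian.E4.basisVector 0) = G x

/-- item stmt-FinalStateConjecture-10225 · crux · rank 2 · open · by planner
why it might fail: False only via a ROUGH (non-t-analytic) vacuum breather in X's class (X ⇒ A trivially), none excluded; the engine needs polynomial-loss high-frequency bounds through trapping, known only for STATIONARY normally hyperbolic trapping (WZ11, Dyatlov16); X allows moving or stable trapping (loss e^{cλ}).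
sources: WunschZworski2011, doi:10.5802/aif.3005, Burq1998, doi:10.1088/0264-9381/33/13/135009, DafermosRodnianskiShlapentokhrothman2014, arXiv:2212.14093
[crux] LEAKAGE WRITES IN INK (card K1 + K2 + P1): under the hypotheses of X alone, G is
real-analytic in t in a UNIFORM STRIP — there are σ > 0 and C such that every component t ↦ G(x + t
e₀)(v,w) is the restriction of a function holomorphic on {|Im z| < σ} bounded by C‖v‖‖w‖, uniformly
over the cylinder (the strip-analyticity clause is verbatim the hypothesis of the shared support
item StaticZoneLiouville). Intended proof: temporal Littlewood–Paley profile a(λ) = sup‖P_λ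
G‖_{C^k}; beyond a threshold frequency each P_λ G is the purely retarded response of the reduced
harmonic-gauge system linearised at the band-limited (entire-in-t) background P_{<λ/16}G to the
high×high paraproduct source (eternity + no incoming radiation at order 1/ρ + red-shift on two-sided
bounds: no free high-frequency content, no real resonances, polynomial resolvent loss λ^N through
hyperbolic trapping); this is the CASCADE INEQUALITY, and SpectralBootstrap converts rapid decay +
cascade into a(λ) ≤ C′e^{−cλ}, i.e. a uniform strip. The one loophole — net heating χ > 0 of the
red-shift cocycle on a moving trapped ray — would put a power-law floor λ^{−γ/χ} under a(λ)
(Doppler/Fermi pumping), contradicting smoo -/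
@[route_item "route-FinalStateConjecture-LeakageWritesInInk", crux]
def LeakageTimeAnalyticity : Prop :=
  ∀ (a r₀ : ℝ) (G : Literature.Geometry.Lorentzian.E4 → Literature.Geometry.Lorentzian.E4 →L[ℝ] Literature.Geometry.Lorentzian.E4 →L[ℝ] ℝ), (0 < r₀ ∧ Literature.Geometry.Lorentzian.MetricCoord.IsMetricOn G (Literature.Geometry.Lorentzian.Kerr.region a r₀ : Set Literature.Geometry.Lorentzian.E4) ∧ (∃ c₀ δ : ℝ, 0 < c₀ ∧ 0 < δ ∧ ∀ x ∈ Literature.Geometry.Lorentzian.Kerr.region a r₀, (Literature.Geometry.Lorentzian.E4.dx 0) (Literature.Geometry.Lorentzian.MetricCoord.sharpAt G x (Literature.Geometry.Lorentzian.E4.dx 0)) ≤ -c₀ ∧ (Literature.Geometry.Lorentzian.Kerr.radius a x < r₀ + δ → (fderiv ℝ (Literature.Geometry.Lorentzian.Kerr.radius a) x) (Literature.Geometry.Lorentzian.MetricCoord.sharpAt G x (fderiv ℝ (Literature.Geometry.Lorentzian.Kerr.radius a) x)) ≤ -c₀ ∧ c₀ ≤ (Literature.Geometry.Lorentzian.E4.dx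 0) (Literature.Geometry.Lorentzian.MetricCoord.sharpAt G x (fderiv ℝ (Literature.Geometry.Lorentzian.Kerr.radius a) x)))) ∧ (∀ x ∈ Literature.Geometry.Lorentzian.Kerr.region a r₀, Literature.Geometry.Lorentzian.MetricCoord.ricAt G x = 0) ∧ (∀ x ∈ Literature.Geometry.Lorentzian.Kerr.region a r₀, ∑ β : Fin 4, Literature.Geometry.Lorentzian.MetricCoord.chrAt G x (Literature.Geometry.Lorentzian.MetricCoord.sharpAt G x (Literature.Geometry.Lorentzian.E4.dx β)) (Literature.Geometry.Lorentzian.E4.basisVector β) = 0) ∧ (∀ k : ℕ, ∃ C : ℝ, ∀ x ∈ Literature.Geometry.Lorentzian.Kerr.region a r₀, ‖iteratedFDeriv ℝ k G x‖ ≤ C ∧ ‖Literature.Geometry.Lorentzian.MetricCoord.sharpAt G x‖ ≤ C) ∧ (∃ C : ℝ, ∀ x ∈ Literature.Geometry.Lorentzian.Kerr.region a r₀, ‖G x - Literature.Geometry.Lorentzian.Minkowski.bilin‖ ≤ C / Literature.Geometry.Lorentzian.E4.spatialNorm x ∧ ‖iteratedFDeriv ℝ 1 G x‖ ≤ C / Literature.Geometry.Lorentzian.E4.spatialNorm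 x ^ 2 ∧ ‖iteratedFDeriv ℝ 2 G x‖ ≤ C / Literature.Geometry.Lorentzian.E4.spatialNorm x ^ 3)) → (∃ σ C : ℝ, 0 < σ ∧ ∀ x ∈ Literature.Geometry.Lorentzian.Kerr.region a r₀, ∀ v w : Literature.Geometry.Lorentzian.E4, ∃ F : ℂ → ℂ, DifferentiableOn ℂ F {z : ℂ | |z.im| < σ} ∧ (∀ z : ℂ, |z.im| < σ → ‖F z‖ ≤ C * ‖v‖ * ‖w‖) ∧ ∀ s : ℝ, F (s : ℂ) = ((G (x + s • Literature.Geometry.Lorentzian.E4.basisVector 0) v w : ℝ) : ℂ))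

/-- item stmt-FinalStateConjecture-18181 · crux · rank 2 · open · by planner
why it might fail: Needs polynomial-loss high-frequency bounds for the linearised gauge-fixed operator on a NON-stationary background with a MOVING trapped set (known only for stationary normally hyperbolic trapping: WZ11, Dyatlov16); stable trapping (loss e^{cλ}), a heating ray or lacunary temporal spectra void it.
sources: WunschZworski2011, doi:10.5802/aif.3005, Burq1998, DafermosRodnianskiShlapentokhrothman2014, arXiv:2212.14093, doi:10.1016/s0021-7824(03)00045-x
[crux] THE CASCADE INEQUALITY (card K1+K2 / CascadeFromTransfer of the route's two-layer plan) for
the CANONICAL temporal Littlewood–Paley TAIL PROFILE of G along ∂₀, pinned inline: β(ξ) =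
smoothTransition(2 − ξ²), χ(ξ) = β(ξ) − β(2ξ) (χ-support ⊂ {1/2 ≤ |ξ| ≤ √2}, Σ_j χ(ξ/2^j) = 1), φ(τ)
= ∫ cos(2πξτ) χ(ξ) dξ (= 𝓕⁻¹χ, Schwartz, even), (P_ν G)(x) = ∫ ν φ(ντ) G(x + τ ∂₀) dτ (temporal
frequency |ξ| ≈ ν piece; Bochner integral of the bilinear-form-valued field), prof k λ = sup {‖D^m
(P_ν G)(x)‖ : ν ≥ λ, m ≤ k, x ∈ Kerr.region a r₀} (tail envelope, decreasing in λ). CLAIM: under the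
hypotheses of X and given boundedness + rapid decay of every prof k (the conclusion of
ProfileTailDecay, fed in by the glue), there are k, N, C > 0, λ₁ such that for every λ ≥ λ₁ some μ ∈
[λ/16, λ/2] has prof k λ ≤ C λ^N · prof k μ · prof k (λ − μ). Intended proof: P_λ G is the purely
retarded response of the reduced harmonic-gauge vacuum operator linearised at the band-limited
background P_{<λ/16}G (low×high paraproduct terms belong to the LINEAR operator) to the high×high
source; eternity + darkness (no 1/ρ radiation) + red-shift on two-sided bounds ⇒ no free
high-frequency content and no real resonances; -/
@[route_item "route-FinalStateConjecture-LeakageWritesInInk"]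
def TemporalCascade : Prop :=
  open Literature.Geometry.Lorentzian in ∀ (a r₀ : ℝ) (G : E4 → E4 →L[ℝ] E4 →L[ℝ] ℝ), (0 < r₀ ∧ MetricCoord.IsMetricOn G (Kerr.region a r₀ : Set E4) ∧ (∃ c₀ δ : ℝ, 0 < c₀ ∧ 0 < δ ∧ ∀ x ∈ Kerr.region a r₀, (E4.dx 0) (MetricCoord.sharpAt G x (E4.dx 0)) ≤ -c₀ ∧ (Kerr.radius a x < r₀ + δ → (fderiv ℝ (Kerr.radius a) x) (MetricCoord.sharpAt G x (fderiv ℝ (Kerr.radius a) x)) ≤ -c₀ ∧ c₀ ≤ (E4.dx 0) (MetricCoord.sharpAt G x (fderiv ℝ (Kerr.radius a) x)))) ∧ (∀ x ∈ Kerr.region a r₀, MetricCoord.ricAt G x = 0) ∧ (∀ x ∈ Kerr.region a r₀, ∑ β : Fin 4, MetricCoord.chrAt G x (MetricCoord.sharpAt G x (E4.dx β)) (E4.basisVector β) = 0) ∧ (∀ k : ℕ, ∃ C : ℝ, ∀ x ∈ Kerr.region a r₀, ‖iteratedFDeriv ℝ k G x‖ ≤ C ∧ ‖MetricCoord.sharpAt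 G x‖ ≤ C) ∧ (∃ C : ℝ, ∀ x ∈ Kerr.region a r₀, ‖G x - Minkowski.bilin‖ ≤ C / E4.spatialNorm x ∧ ‖iteratedFDeriv ℝ 1 G x‖ ≤ C / E4.spatialNorm x ^ 2 ∧ ‖iteratedFDeriv ℝ 2 G x‖ ≤ C / E4.spatialNorm x ^ 3)) → ∀ prof : ℕ → ℝ → ℝ, prof = (fun (k : ℕ) (lam : ℝ) => sSup {q : ℝ | ∃ ν : ℝ, lam ≤ ν ∧ ∃ m : ℕ, m ≤ k ∧ ∃ x ∈ Kerr.region a r₀, q = ‖iteratedFDeriv ℝ m (fun y : E4 => ∫ τ : ℝ, (ν * (∫ ξ : ℝ, Real.cos (2 * Real.pi * ξ * (ν * τ)) * (Real.smoothTransition (2 - ξ ^ 2) - Real.smoothTransition (2 - (2 * ξ) ^ 2)))) • G (y + τ • E4.basisVector 0)) x‖}) → (∀ k : ℕ, (∃ M : ℝ, 0 < M ∧ ∀ lam : ℝ, 0 ≤ prof k lam ∧ prof k lam ≤ M) ∧ ∀ K : ℕ, ∃ C' : ℝ, ∀ lam : ℝ, 1 ≤ lam → prof k lam ≤ C' / lam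 ^ K) → ∃ (k N : ℕ) (C lam₁ : ℝ), 0 < C ∧ ∀ lam : ℝ, lam₁ ≤ lam → ∃ μ ∈ Set.Icc (lam / 16) (lam / 2), prof k lam ≤ C * lam ^ N * (prof k μ * prof k (lam - μ))

/-- item stmt-FinalStateConjecture-10226 · crux · rank 3 · open · by planner
why it might fail: Tools stop at the belt: Alexakis–Schlue reach only near infinity (interior blocked by trapped null geodesics, 1504.04592 p.4); t-analytic Tataru UC is free only where ∂ₜ is timelike (KKL Thm 2.66); in a non-Kerr ergo-belt zero-energy null convexity is unverified: a belt-supported breather passes.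
sources: doi:10.1016/s0021-7824(99)00016-1, doi:10.1080/03605309508821117, doi:10.1007/s002220050212, doi:10.4171/jems/854, book:kachalov2001-inverse-boundary-spectral-problems, arXiv:1504.04592
[crux] TIME-ANALYTIC LIOUVILLE (card K3, consumer of rank 2): under the hypotheses of X, if G is
real-analytic in t in a uniform strip (the conclusion of LeakageTimeAnalyticity, verbatim), then G
is t-independent on the whole cylinder. Intended proof: h = ∂ₜG solves the linearisation of the
autonomous reduced vacuum system at G EXACTLY, with coefficients analytic in t; far zone:
StaticZoneLiouville (Fourier in t + Rellich–Vekua kills h near infinity, the t-analytic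
Tataru–Robbiano–Zuily–Hörmander theorem sweeps coordinate spheres inward); photon region: wherever
∂ₜ is timelike the operator is transversally elliptic on {τ = 0} and continuation crosses EVERY
surface with no convexity at all; ergo-belt: pseudoconvexity is needed only against null
bicharacteristics annihilating ∂ₜ — ZERO-ENERGY null geodesics — i.e. Ionescu–Klainerman's
T-conditional pseudoconvexity of the limit (verified at and near Kerr), or the zero-energy
Kerr-or-bomb dichotomy of the sibling cards; collar inside the horizon: two-sided bounds +
blue-shift backwards (κ > 0) + domain of dependence. Strictly stronger than
TemporalBandLiouville.BandLimitedLiouville (weaker hypothesis), with the same engine outside the -/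
@[route_item "route-FinalStateConjecture-LeakageWritesInInk", crux]
def TimeAnalyticLiouville : Prop :=
  ∀ (a r₀ : ℝ) (G : Literature.Geometry.Lorentzian.E4 → Literature.Geometry.Lorentzian.E4 →L[ℝ] Literature.Geometry.Lorentzian.E4 →L[ℝ] ℝ), (0 < r₀ ∧ Literature.Geometry.Lorentzian.MetricCoord.IsMetricOn G (Literature.Geometry.Lorentzian.Kerr.region a r₀ : Set Literature.Geometry.Lorentzian.E4) ∧ (∃ c₀ δ : ℝ, 0 < c₀ ∧ 0 < δ ∧ ∀ x ∈ Literature.Geometry.Lorentzian.Kerr.region a r₀, (Literature.Geometry.Lorentzian.E4.dx 0) (Literature.Geometry.Lorentzian.MetricCoord.sharpAt G x (Literature.Geometry.Lorentzian.E4.dx 0)) ≤ -c₀ ∧ (Literature.Geometry.Lorentzian.Kerr.radius a x < r₀ + δ → (fderiv ℝ (Literature.Geometry.Lorentzian.Kerr.radius a) x) (Literature.Geometry.Lorentzian.MetricCoord.sharpAt G x (fderiv ℝ (Literature.Geometry.Lorentzian.Kerr.radius a) x)) ≤ -c₀ ∧ c₀ ≤ (Literature.Geometry.Lorentzian.E4.dx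 0) (Literature.Geometry.Lorentzian.MetricCoord.sharpAt G x (fderiv ℝ (Literature.Geometry.Lorentzian.Kerr.radius a) x)))) ∧ (∀ x ∈ Literature.Geometry.Lorentzian.Kerr.region a r₀, Literature.Geometry.Lorentzian.MetricCoord.ricAt G x = 0) ∧ (∀ x ∈ Literature.Geometry.Lorentzian.Kerr.region a r₀, ∑ β : Fin 4, Literature.Geometry.Lorentzian.MetricCoord.chrAt G x (Literature.Geometry.Lorentzian.MetricCoord.sharpAt G x (Literature.Geometry.Lorentzian.E4.dx β)) (Literature.Geometry.Lorentzian.E4.basisVector β) = 0) ∧ (∀ k : ℕ, ∃ C : ℝ, ∀ x ∈ Literature.Geometry.Lorentzian.Kerr.region a r₀, ‖iteratedFDeriv ℝ k G x‖ ≤ C ∧ ‖Literature.Geometry.Lorentzian.MetricCoord.sharpAt G x‖ ≤ C) ∧ (∃ C : ℝ, ∀ x ∈ Literature.Geometry.Lorentzian.Kerr.region a r₀, ‖G x - Literature.Geometry.Lorentzian.Minkowski.bilin‖ ≤ C / Literature.Geometry.Lorentzian.E4.spatialNorm x ∧ ‖iteratedFDeriv ℝ 1 G x‖ ≤ C / Literature.Geometry.Lorentzian.E4.spatialNorm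 x ^ 2 ∧ ‖iteratedFDeriv ℝ 2 G x‖ ≤ C / Literature.Geometry.Lorentzian.E4.spatialNorm x ^ 3)) → (∃ σ C : ℝ, 0 < σ ∧ ∀ x ∈ Literature.Geometry.Lorentzian.Kerr.region a r₀, ∀ v w : Literature.Geometry.Lorentzian.E4, ∃ F : ℂ → ℂ, DifferentiableOn ℂ F {z : ℂ | |z.im| < σ} ∧ (∀ z : ℂ, |z.im| < σ → ‖F z‖ ≤ C * ‖v‖ * ‖w‖) ∧ ∀ s : ℝ, F (s : ℂ) = ((G (x + s • Literature.Geometry.Lorentzian.E4.basisVector 0) v w : ℝ) : ℂ)) → ∀ x ∈ Literature.Geometry.Lorentzian.Kerr.region a r₀, ∀ s : ℝ, G (x + s • Literature.Geometry.Lorentzian.E4.basisVector 0) = G x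

/-- item stmt-FinalStateConjecture-10173 · crux · rank 4 · open · by planner
why it might fail: X → FSC still contains generic weak cosmic censorship (complete 𝓘⁺), C^k-precompactness of late exteriors in comoving harmonic gauge to the horizon (no theorem; Burnett weak limits), smooth stationary ⇒ Kerr beyond near-Kerr (open), κ>0 genericity, Kerr capture for all |a|<M (known only for |a|≪M).
sources: Christodoulou1999, arXiv:1710.01722, arXiv:2104.11857, arXiv:2205.14808, arXiv:2104.08222, arXiv:1907.10743
[crux] THE STATIONARY-LIMIT ARCHITECTURE: X → FinalStateConjecture. Informally: (i) for a
Christodoulou-generic admissible datum the MGHD exists, has complete 𝓘⁺, and its exterior admits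
late-time comoving harmonic charts with two-sided C^k bounds, so that every ω-limit
(time-translation limit) around each final concentration region is a G satisfying the hypotheses of
X (excised inside the apparent horizon, stationary-rate fall-off because Bondi mass and horizon area
are constant on ω-limits), or is empty (dispersal); (ii) by X the limit is stationary, hence (smooth
black-hole uniqueness in this class) a sub-extremal Kerr exterior, generically; (iii) uniqueness of
the limit plus Kerr capture (nonlinear stability) upgrades subsequential convergence to the C²
`FinalStateDecomposition` with `HasExhaustiveCharts`, receding holes pairwise separating. Shared
with the LaSalle/dissipation-budget/Burnett cards; filed here so that the route decides the
Statement. [deps: EternalExteriorStationary] [difficulty: open-problem] -/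
@[route_item "route-FinalStateConjecture-LeakageWritesInInk", crux]
def StationaryLimitReduction : Prop :=
  EternalExteriorStationary → _root_.FinalStateConjecture

/-- item stmt-FinalStateConjecture-10175 · support · rank 9 · open · by planner
sources: doi:10.1080/03605309508821117, doi:10.4171/jems/854, AlexakisSchlue2018, BicakScholtzTod2010
[support] THE KNOWN-TECHNOLOGY HALF OF C2 (Rellich zone + time-analytic continuation, belt
excluded): under the hypotheses of X, if G is merely time-ANALYTIC IN A UNIFORM STRIP (each
component extends holomorphically to {|Im z| < σ}, bounded by C‖v‖‖w‖) and on the far zone {ρ ≥ r₁}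
the field ∂_t is uniformly timelike (G(e₀,e₀) ≤ −c₁) and the coordinate spheres are uniformly
non-characteristic (g⁻¹(dρ,dρ) ≥ c₁), then G is t-independent on {ρ > r₁}. Proof plan: h = ∂_tG
solves the linearised reduced system; Fourier in t + Rellich–Vekua for the weakly coupled Helmholtz
system with Coulomb tails kills h near infinity; Tataru–Robbiano–Zuily–Hörmander (transversally
elliptic case (E)) sweeps the spheres inward, uniformly in t by the C^k bounds. Serves
eternal-papapetrou-temporal-spectrum as well (its conditional K3(ii)). [difficulty: L] -/
@[route_item "route-FinalStateConjecture-LeakageWritesInInk", crux]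
def StaticZoneLiouville : Prop :=
  ∀ (a r₀ r₁ : ℝ) (G : Literature.Geometry.Lorentzian.E4 → Literature.Geometry.Lorentzian.E4 →L[ℝ] Literature.Geometry.Lorentzian.E4 →L[ℝ] ℝ), (0 < r₀ ∧ Literature.Geometry.Lorentzian.MetricCoord.IsMetricOn G (Literature.Geometry.Lorentzian.Kerr.region a r₀ : Set Literature.Geometry.Lorentzian.E4) ∧ (∃ c₀ δ : ℝ, 0 < c₀ ∧ 0 < δ ∧ ∀ x ∈ Literature.Geometry.Lorentzian.Kerr.region a r₀, (Literature.Geometry.Lorentzian.E4.dx 0) (Literature.Geometry.Lorentzian.MetricCoord.sharpAt G x (Literature.Geometry.Lorentzian.E4.dx 0)) ≤ -c₀ ∧ (Literature.Geometry.Lorentzian.Kerr.radius a x < r₀ + δ → (fderiv ℝ (Literature.Geometry.Lorentzian.Kerr.radius a) x) (Literature.Geometry.Lorentzian.MetricCoord.sharpAt G x (fderiv ℝ (Literature.Geometry.Lorentzian.Kerr.radius a) x)) ≤ -c₀ ∧ c₀ ≤ (Literature.Geometry.Lorentzian.E4.dx 0) (Literature.Geometry.Lorentzian.MetricCoord.sharpAt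 G x (fderiv ℝ (Literature.Geometry.Lorentzian.Kerr.radius a) x)))) ∧ (∀ x ∈ Literature.Geometry.Lorentzian.Kerr.region a r₀, Literature.Geometry.Lorentzian.MetricCoord.ricAt G x = 0) ∧ (∀ x ∈ Literature.Geometry.Lorentzian.Kerr.region a r₀, ∑ β : Fin 4, Literature.Geometry.Lorentzian.MetricCoord.chrAt G x (Literature.Geometry.Lorentzian.MetricCoord.sharpAt G x (Literature.Geometry.Lorentzian.E4.dx β)) (Literature.Geometry.Lorentzian.E4.basisVector β) = 0) ∧ (∀ k : ℕ, ∃ C : ℝ, ∀ x ∈ Literature.Geometry.Lorentzian.Kerr.region a r₀, ‖iteratedFDeriv ℝ k G x‖ ≤ C ∧ ‖Literature.Geometry.Lorentzian.MetricCoord.sharpAt G x‖ ≤ C) ∧ (∃ C : ℝ, ∀ x ∈ Literature.Geometry.Lorentzian.Kerr.region a r₀, ‖G x - Literature.Geometry.Lorentzian.Minkowski.bilin‖ ≤ C / Literature.Geometry.Lorentzian.E4.spatialNorm x ∧ ‖iteratedFDeriv ℝ 1 G x‖ ≤ C / Literature.Geometry.Lorentzian.E4.spatialNorm x ^ 2 ∧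 ‖iteratedFDeriv ℝ 2 G x‖ ≤ C / Literature.Geometry.Lorentzian.E4.spatialNorm x ^ 3)) → (∃ σ C : ℝ, 0 < σ ∧ ∀ x ∈ Literature.Geometry.Lorentzian.Kerr.region a r₀, ∀ v w : Literature.Geometry.Lorentzian.E4, ∃ F : ℂ → ℂ, DifferentiableOn ℂ F {z : ℂ | |z.im| < σ} ∧ (∀ z : ℂ, |z.im| < σ → ‖F z‖ ≤ C * ‖v‖ * ‖w‖) ∧ ∀ s : ℝ, F (s : ℂ) = ((G (x + s • Literature.Geometry.Lorentzian.E4.basisVector 0) v w : ℝ) : ℂ)) → (∃ c₁ : ℝ, 0 < c₁ ∧ ∀ x ∈ Literature.Geometry.Lorentzian.Kerr.region a r₀, r₁ ≤ Literature.Geometry.Lorentzian.E4.spatialNorm x → G x (Literature.Geometry.Lorentzian.E4.basisVector 0) (Literature.Geometry.Lorentzian.E4.basisVector 0) ≤ -c₁ ∧ c₁ ≤ (fderiv ℝ Literature.Geometry.Lorentzian.E4.spatialNorm x) (Literature.Geometry.Lorentzian.MetricCoord.sharpAt G x (fderiv ℝ Literature.Geometry.Lorentzian.E4.spatialNorm x)))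 → ∀ x ∈ Literature.Geometry.Lorentzian.Kerr.region a r₀, r₁ < Literature.Geometry.Lorentzian.E4.spatialNorm x → ∀ s : ℝ, G (x + s • Literature.Geometry.Lorentzian.E4.basisVector 0) = G x

/-- item stmt-FinalStateConjecture-10227 · support · rank 9 · open · by planner
sources: FoiasTemam1989, doi:10.1512/iumj.1998.47.1465
[support] THE SPECTRAL BOOTSTRAP (card P1(a), pure real analysis, Mathlib-provable now): a profile a
: ℝ → [0,1] with rapid decay (∀K, a(λ) ≤ C_K λ^{−K} for λ ≥ 1) and the cascade inequality (for λ ≥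
λ₁ some μ ∈ [λ/16, λ/2] has a(λ) ≤ Cλ^N a(μ)a(λ−μ), C > 0) decays exponentially: a(λ) ≤ C′e^{−cλ}
for λ ≥ 1 with c > 0. Proof (checked by hand): induction over shells [Λ, 16Λ/15) on the claim a(ν) ≤
D e^{−ν/λ*} ν^{−(N+1)} for ν ≥ λ*/16, base window [λ*/16, λ*) from rapid decay at order N+2, step
from μ(λ−μ) ≥ λ²/32, with λ* = max(λ₁, 16, (16e·C·C_{N+2}·32^{N+1})^{1/2}), D = 16e·C_{N+2}/λ*;
exponentials are the fixed points of the cascade convolution (card kit j001373: no sublinear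
regime). [difficulty: provable-now] -/
@[route_item "route-FinalStateConjecture-LeakageWritesInInk", crux]
def SpectralBootstrap : Prop :=
  ∀ (a : ℝ → ℝ) (N : ℕ) (C lam₁ : ℝ), 0 < C → (∀ lam : ℝ, 0 ≤ a lam ∧ a lam ≤ 1) → (∀ K : ℕ, ∃ C' : ℝ, ∀ lam : ℝ, 1 ≤ lam → a lam ≤ C' / lam ^ K) → (∀ lam : ℝ, lam₁ ≤ lam → ∃ μ ∈ Set.Icc (lam / 16) (lam / 2), a lam ≤ C * lam ^ N * (a μ * a (lam - μ))) → ∃ c C' : ℝ, 0 < c ∧ ∀ lam : ℝ, 1 ≤ lam → a lam ≤ C' * Real.exp (-(c * lam))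

/-- item stmt-FinalStateConjecture-10228 · support · rank 9 · closed · proved by Summit.FinalStateConjecture.FinalStateConjecture.Theorems.inkChain_proof @ b4d2876abc71 (prover) · by planner
sources: doi:10.1016/s0021-7824(99)00016-1
[support] the two cruxes compose to the shared target by pure logic (the hypothesis bundles are
syntactically identical; `inkChain_holds` in Sketch.lean): LeakageTimeAnalyticity →
TimeAnalyticLiouville → EternalExteriorStationary. [difficulty: provable-now] -/
@[route_item "route-FinalStateConjecture-LeakageWritesInInk", crux]
def InkChain : Prop :=
  LeakageTimeAnalyticity → TimeAnalyticLiouville → EternalExteriorStationary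

-- `InkChain` holds: proved by `Summit.FinalStateConjecture.FinalStateConjecture.Theorems.inkChain_proof` @ b4d2876abc71 (its module imports this route file, so no `_holds` link can be stated here).

/-- item stmt-FinalStateConjecture-18240 · support · rank 9 · open · by planner
sources: doi:10.1007/978-3-642-16830-7, FoiasTemam1989
[support] BOUNDEDNESS AND RAPID DECAY OF THE CANONICAL TEMPORAL PROFILE (classical Littlewood–Paley;
provable now, size L): with β, χ, φ, P_ν, prof as in TemporalCascade, under the hypotheses of X
(only smoothness on the open t-invariant region and the uniform C^k bounds are used), for every k
there is M > 0 with 0 ≤ prof k λ ≤ M for ALL real λ, and for every K a C_K with prof k λ ≤ C_K/λ^K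
for λ ≥ 1. Proof plan: χ vanishes near 0, so φ = ψ_K^{(K)} with ψ_K = 𝓕⁻¹[χ(ξ)/(2πiξ)^K] Schwartz;
integrate by parts K times along ∂₀ (‖P_ν D^m G‖ ≤ ν^{−K} ‖ψ_K‖₁ sup ‖D^{m+K} G‖), differentiate
under the Bochner integral (dominated convergence from the uniform bounds), ‖ν φ(ν·)‖₁ = ‖φ‖₁ for ν
≠ 0 and P₀ = 0; the sSup bookkeeping is Real.sSup_le / Real.sSup_nonneg (empty or unbounded sets are
harmless: the bounds are proved pointwise first). Feeds TemporalCascade (hypothesis) and the glue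
(normalisation into [0,1] for SpectralBootstrap). [sources: doi:10.1007/978-3-642-16830-7,
FoiasTemam1989] -/
@[route_item "route-FinalStateConjecture-LeakageWritesInInk"]
def ProfileTailDecay : Prop :=
  open Literature.Geometry.Lorentzian in ∀ (a r₀ : ℝ) (G : E4 → E4 →L[ℝ] E4 →L[ℝ] ℝ), (0 < r₀ ∧ MetricCoord.IsMetricOn G (Kerr.region a r₀ : Set E4) ∧ (∃ c₀ δ : ℝ, 0 < c₀ ∧ 0 < δ ∧ ∀ x ∈ Kerr.region a r₀, (E4.dx 0) (MetricCoord.sharpAt G x (E4.dx 0)) ≤ -c₀ ∧ (Kerr.radius a x < r₀ + δ → (fderiv ℝ (Kerr.radius a) x) (MetricCoord.sharpAt G x (fderiv ℝ (Kerr.radius a) x)) ≤ -c₀ ∧ c₀ ≤ (E4.dx 0) (MetricCoord.sharpAt G x (fderiv ℝ (Kerr.radius a) x)))) ∧ (∀ x ∈ Kerr.region a r₀, MetricCoord.ricAt G x = 0) ∧ (∀ x ∈ Kerr.region a r₀, ∑ β : Fin 4, MetricCoord.chrAt G x (MetricCoord.sharpAt G x (E4.dx β)) (E4.basisVector β) =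 0) ∧ (∀ k : ℕ, ∃ C : ℝ, ∀ x ∈ Kerr.region a r₀, ‖iteratedFDeriv ℝ k G x‖ ≤ C ∧ ‖MetricCoord.sharpAt G x‖ ≤ C) ∧ (∃ C : ℝ, ∀ x ∈ Kerr.region a r₀, ‖G x - Minkowski.bilin‖ ≤ C / E4.spatialNorm x ∧ ‖iteratedFDeriv ℝ 1 G x‖ ≤ C / E4.spatialNorm x ^ 2 ∧ ‖iteratedFDeriv ℝ 2 G x‖ ≤ C / E4.spatialNorm x ^ 3)) → ∀ prof : ℕ → ℝ → ℝ, prof = (fun (k : ℕ) (lam : ℝ) => sSup {q : ℝ | ∃ ν : ℝ, lam ≤ ν ∧ ∃ m : ℕ, m ≤ k ∧ ∃ x ∈ Kerr.region a r₀, q = ‖iteratedFDeriv ℝ m (fun y : E4 => ∫ τ : ℝ, (ν * (∫ ξ : ℝ, Real.cos (2 * Real.pi * ξ * (ν * τ)) * (Real.smoothTransition (2 - ξ ^ 2) - Real.smoothTransition (2 - (2 * ξ) ^ 2)))) • G (y + τ • E4.basisVector 0)) x‖}) → ∀ k : ℕ, (∃ M : ℝ, 0 < M ∧ ∀ lam :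 ℝ, 0 ≤ prof k lam ∧ prof k lam ≤ M) ∧ ∀ K : ℕ, ∃ C' : ℝ, ∀ lam : ℝ, 1 ≤ lam → prof k lam ≤ C' / lam ^ K

/-- item stmt-FinalStateConjecture-18241 · support · rank 9 · open · by planner
sources: doi:10.1007/978-3-642-16830-7, doi:10.1090/coll/019
[support] PALEY–WIENER SYNTHESIS (classical; provable now, size L): with β, χ, φ, P_ν, prof as in
TemporalCascade, under the hypotheses of X, if SOME tail profile decays exponentially, prof k λ ≤
C′e^{−cλ} for λ ≥ 1 (c > 0), then G is time-analytic in a uniform strip — verbatim the conclusion of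
LeakageTimeAnalyticity (any σ < c/(2π√2·2) works). Proof plan: for f(s) = G(x + s∂₀)(v,w): f = P_low
f + Σ_{j≥0} P_{2^j} f pointwise (dyadic partition Σ_j χ(ξ/2^j) = 1; the partial sums are f ∗ 2^J
Φ(2^J·), Φ = 𝓕⁻¹β(·) an approximate identity, f bounded smooth); P_{2^j} f = P̃_{2^j} P_{2^j} f with
χ̃ = 1 on supp χ, so P_{2^j} f extends to an ENTIRE function bounded by ‖P_{2^j} f‖_∞ · A e^{B 2^j
|Im z|} (the kernel of P̃ is the Fourier transform of a compactly supported bump: Paley–Wiener), and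
‖P_{2^j} f‖_∞ ≤ prof k (2^j) ‖v‖‖w‖ ≤ C′e^{−c 2^j}‖v‖‖w‖; the low part is entire of exponential type
with ‖f‖_∞ ≤ C₀‖v‖‖w‖; the series converges locally uniformly on {|Im z| < c/(2B)} (holomorphic
limit, uniform bound). NB: a CONSEQUENCE of the parent (LeakageTimeAnalyticity →
StripFromProfileDecay by discarding the profile hypotheses), used toward it in the glue. [sources:
doi:10.1007/978-3-642-16830 -/
@[route_item "route-FinalStateConjecture-LeakageWritesInInk"]
def StripFromProfileDecay : Prop :=
  open Literature.Geometry.Lorentzian in ∀ (a r₀ : ℝ) (G : E4 → E4 →L[ℝ] E4 →L[ℝ] ℝ), (0 < r₀ ∧ MetricCoord.IsMetricOn G (Kerr.region a r₀ : Set E4) ∧ (∃ c₀ δ : ℝ, 0 < c₀ ∧ 0 < δ ∧ ∀ x ∈ Kerr.region a r₀, (E4.dx 0) (MetricCoord.sharpAt G x (E4.dx 0)) ≤ -c₀ ∧ (Kerr.radius a x < r₀ + δ → (fderiv ℝ (Kerr.radius a) x) (MetricCoord.sharpAt G x (fderiv ℝ (Kerr.radius a) x)) ≤ -c₀ ∧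 c₀ ≤ (E4.dx 0) (MetricCoord.sharpAt G x (fderiv ℝ (Kerr.radius a) x)))) ∧ (∀ x ∈ Kerr.region a r₀, MetricCoord.ricAt G x = 0) ∧ (∀ x ∈ Kerr.region a r₀, ∑ β : Fin 4, MetricCoord.chrAt G x (MetricCoord.sharpAt G x (E4.dx β)) (E4.basisVector β) = 0) ∧ (∀ k : ℕ, ∃ C : ℝ, ∀ x ∈ Kerr.region a r₀, ‖iteratedFDeriv ℝ k G x‖ ≤ C ∧ ‖MetricCoord.sharpAt G x‖ ≤ C) ∧ (∃ C : ℝ, ∀ x ∈ Kerr.region a r₀, ‖G x - Minkowski.bilin‖ ≤ C / E4.spatialNorm x ∧ ‖iteratedFDeriv ℝ 1 G x‖ ≤ C / E4.spatialNorm x ^ 2 ∧ ‖iteratedFDeriv ℝ 2 G x‖ ≤ C / E4.spatialNorm x ^ 3)) → ∀ prof : ℕ → ℝ → ℝ, prof = (fun (k : ℕ) (lam : ℝ) => sSup {q : ℝ | ∃ ν : ℝ, lam ≤ ν ∧ ∃ m : ℕ, m ≤ k ∧ ∃ x ∈ Kerr.region a r₀, q = ‖iteratedFDeriv ℝ m (fun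 y : E4 => ∫ τ : ℝ, (ν * (∫ ξ : ℝ, Real.cos (2 * Real.pi * ξ * (ν * τ)) * (Real.smoothTransition (2 - ξ ^ 2) - Real.smoothTransition (2 - (2 * ξ) ^ 2)))) • G (y + τ • E4.basisVector 0)) x‖}) → (∃ (k : ℕ) (c C' : ℝ), 0 < c ∧ ∀ lam : ℝ, 1 ≤ lam → prof k lam ≤ C' * Real.exp (-(c * lam))) → (∃ σ C : ℝ, 0 < σ ∧ ∀ x ∈ Kerr.region a r₀, ∀ v w : E4, ∃ F : ℂ → ℂ, DifferentiableOn ℂ F {z : ℂ | |z.im| < σ} ∧ (∀ z : ℂ, |z.im| < σ → ‖F z‖ ≤ C * ‖v‖ * ‖w‖) ∧ ∀ s : ℝ, F (s : ℂ) = ((G (x + s • E4.basisVector 0) v w : ℝ) : ℂ))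

/-- item stmt-FinalStateConjecture-18326 · support · rank 9 · open · by planner
sources: FoiasTemam1989, doi:10.1512/iumj.1998.47.1465
[support] GLUE OF THE LAYER-2 SPLIT OF LeakageTimeAnalyticity (strategist cstrat-10225; provable now
— candidate proof attached as evidence, Glue.lean, 45 lines, lean check rc0, axioms standard):
TemporalCascade → ProfileTailDecay → StripFromProfileDecay → LeakageTimeAnalyticity. Proof:
instantiate the three children at the canonical temporal tail profile (prof = the pinned term, by
rfl), feed ProfileTailDecay's decay package into TemporalCascade, rescale b := prof k / M into [0,1]
(cascade constant C ↦ C·M, decay constants C_K ↦ C_K/M), apply the PROVED SpectralBootstrap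
(Summit.FinalStateConjecture.FinalStateConjecture.Theorems.LeakageWritesInInk.spectralBootstrap_proof
b N (C·M) λ₁ …) for exponential decay, unscale (prof k λ = b λ · M ≤ C′M e^{−cλ}), apply
StripFromProfileDecay. With it LeakageTimeAnalyticity is DERIVED from the three children; the tenure
planner may convert to a formal split (route edit --split LeakageTimeAnalyticity --glue-by <this
theorem>) once landed. [sources: FoiasTemam1989, doi:10.1512/iumj.1998.47.1465] -/
@[route_item "route-FinalStateConjecture-LeakageWritesInInk"]
def LeakageTimeAnalyticityOfSplit : Prop :=
  TemporalCascade → ProfileTailDecay → StripFromProfileDecay → LeakageTimeAnalyticity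

/-- item stmt-FinalStateConjecture-10229 · assembly · rank 1 · closed · proved by Summit.FinalStateConjecture.FinalStateConjecture.Theorems.leakageWritesInInk_assembly_proof @ 9c1c2984f467 (prover) · by planner
sources: DafermosLuk2017, doi:10.1016/s0021-7824(99)00016-1
[assembly] LeakageTimeAnalyticity → TimeAnalyticLiouville → StationaryLimitReduction →
FinalStateConjecture. -/
@[route_item "route-FinalStateConjecture-LeakageWritesInInk", crux]
def Assembly : Prop :=
  LeakageTimeAnalyticity → TimeAnalyticLiouville → StationaryLimitReduction → _root_.FinalStateConjecture

-- `Assembly` holds: proved by `Summit.FinalStateConjecture.FinalStateConjecture.Theorems.leakageWritesInInk_assembly_proof` @ 9c1c2984f467 (its module imports this route file, so no `_holds` link can be stated here).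

/-! D-0027 §2.1 — DECIDING THEOREM (planner-authored via `route open/edit --closes-file`; by planner-plancard-FinalStateConjecture-FinalSt-de58c9be-0 2026-08-15T15:36:42Z):
its hypotheses are this route's items and its conclusion the sub-problem Statement (glue_lint), and it elaborates with this file. -/

@[closes "route-FinalStateConjecture-LeakageWritesInInk"] theorem closes (hX : EternalExteriorStationary) (hA : LeakageTimeAnalyticity)
    (hS : TimeAnalyticLiouville) (hR : StationaryLimitReduction) (hZ : StaticZoneLiouville)
    (hP : SpectralBootstrap) (hC : InkChain) (hAsm : Assembly) :
    _root_.FinalStateConjecture :=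
  hR (fun a r₀ G h ↦ hS a r₀ G h (hA a r₀ G h))

end Summit.FinalStateConjecture.FinalStateConjecture.Theses.LeakageWritesInInk
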